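import Mathlib

/-!
# P7 · HARRIS–FKG, finite-volume form (seat p3, blind cell pub-perc-repro0)

Kernel-checked twin of Lemma 7.2 of `proofs/P7-fkg-p3-v1.md` (finite product of Bernoulli laws,
parameters `p i ∈ [0,1]`): for monotone non-negative `f g : (ι → Bool) → ℝ`,

  `(∑ ω, w ω * f ω) * (∑ ω, w ω * g ω) ≤ ∑ ω, w ω * (f ω * g ω)`,

where `w ω = ∏ i, (if ω i then p i else 1 - p i)` is the product Bernoulli weight (a configuration
`ω : ι → Bool` lists which of the finitely many edges `i` are open), and the event form for two
increasing (upper) sets `A B`: `(∑ ω ∈ A, w ω) * (∑ ω ∈ B, w ω) ≤ ∑ ω ∈ A ∩ B, w ω`.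
The proof is Mathlib's `fkg` (four-functions theorem) applied to the log-modular weight `w`,
plus `∑ ω, w ω = 1`. No definitions are introduced (the weight is written out each time).
-/

namespace Summit.Ventures.PercRepro0.HarrisFinite

open Finset

variable {ι : Type*} [Fintype ι] [DecidableEq ι]

/-- The lattice operations of `Bool` are `&&` and `||`. -/
theorem bool_inf_eq_and (a b : Bool) : (a ⊓ b) = (a && b) := by cases a <;> cases b <;> decide

/-- The lattice operations of `Bool` are `&&` and `||`. -/
theorem bool_sup_eq_or (a b : Bool) : (a ⊔ b) = (a || b) := by cases a <;> cases b <;> decide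

omit [DecidableEq ι] in
/-- The product Bernoulli weight is non-negative. -/
theorem weight_nonneg (p : ι → ℝ) (hp0 : ∀ i, 0 ≤ p i) (hp1 : ∀ i, p i ≤ 1) (ω : ι → Bool) :
    0 ≤ ∏ i, (if ω i then p i else 1 - p i) := by
  refine Finset.prod_nonneg fun i _ => ?_
  split_ifs
  · exact hp0 i
  · linarith [hp1 i]

/-- One coordinate: `w(a) w(b) = w(a ⊓ b) w(a ⊔ b)` on `Bool`. -/
theorem weight_coord_logmodular (q : ℝ) (a b : Bool) :
    (if a = true then q else 1 - q) * (if b = true then q else 1 - q)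
      = (if (a ⊓ b) = true then q else 1 - q) * (if (a ⊔ b) = true then q else 1 - q) := by
  rw [bool_inf_eq_and, bool_sup_eq_or]
  cases a <;> cases b <;> simp [mul_comm]

omit [DecidableEq ι] in
/-- The product Bernoulli weight is log-modular: `w a * w b = w (a ⊓ b) * w (a ⊔ b)`. -/
theorem weight_logmodular (p : ι → ℝ) (a b : ι → Bool) :
    (∏ i, (if a i then p i else 1 - p i)) * (∏ i, (if b i then p i else 1 - p i))
      = (∏ i, (if (a ⊓ b) i = true then p i else 1 - p i))
          * (∏ i, (if (a ⊔ b) i = true then p i else 1 - p i)) := by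
  rw [← Finset.prod_mul_distrib, ← Finset.prod_mul_distrib]
  refine Finset.prod_congr rfl fun i _ => ?_
  simp only [Pi.inf_apply, Pi.sup_apply]
  exact weight_coord_logmodular (p i) (a i) (b i)

/-- The product Bernoulli weights sum to one. -/
theorem sum_weight (p : ι → ℝ) : ∑ ω : ι → Bool, ∏ i, (if ω i then p i else 1 - p i) = 1 := by
  have h : ∏ i : ι, ∑ b ∈ (Finset.univ : Finset Bool), (if b = true then p i else 1 - p i)
      = ∑ ω ∈ Fintype.piFinset (fun _ : ι => (Finset.univ : Finset Bool)),
          ∏ i, (if ω i = true then p i else 1 - p i) :=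
    Finset.prod_univ_sum (fun _ => Finset.univ) (fun i b => if b = true then p i else 1 - p i)
  rw [Fintype.piFinset_univ] at h
  rw [← h]
  refine Finset.prod_eq_one fun i _ => ?_
  simp

/-- Lemma 7.2 of P7 (non-negative form): finite-volume Harris–FKG for monotone non-negative
functions under the product Bernoulli weight. -/
theorem harris_finite_fun (p : ι → ℝ) (hp0 : ∀ i, 0 ≤ p i) (hp1 : ∀ i, p i ≤ 1)
    (f g : (ι → Bool) → ℝ) (hf0 : 0 ≤ f) (hg0 : 0 ≤ g) (hf : Monotone f) (hg : Monotone g) :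
    (∑ ω, (∏ i, (if ω i then p i else 1 - p i)) * f ω)
        * (∑ ω, (∏ i, (if ω i then p i else 1 - p i)) * g ω)
      ≤ ∑ ω, (∏ i, (if ω i then p i else 1 - p i)) * (f ω * g ω) := by
  have key := fkg (μ := fun ω : ι → Bool => ∏ i, (if ω i then p i else 1 - p i)) (f := f) (g := g)
    (fun ω => weight_nonneg p hp0 hp1 ω) hf0 hg0 hf hg
    (fun a b => (weight_logmodular p a b).le)
  beta_reduce at key
  rw [sum_weight p, one_mul] at key
  exact key

omit [DecidableEq ι] in
/-- Indicator of an upper set is monotone. -/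
theorem monotone_indicator_of_isUpperSet (A : Finset (ι → Bool))
    (hA : IsUpperSet (A : Set (ι → Bool))) :
    Monotone (fun ω : ι → Bool => if ω ∈ A then (1 : ℝ) else 0) := by
  intro a b hab
  by_cases ha : a ∈ A
  · have hb : b ∈ A := hA hab ha
    simp [ha, hb]
  · simp only [ha, if_false]
    split_ifs <;> norm_num

/-- P7, finite-volume event form: for two increasing (upper) sets of configurations,
`P(A) P(B) ≤ P(A ∩ B)` under the product Bernoulli weight. -/
theorem harris_finite_upperSet (p : ι → ℝ) (hp0 : ∀ i, 0 ≤ p i) (hp1 : ∀ i, p i ≤ 1)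
    (A B : Finset (ι → Bool)) (hA : IsUpperSet (A : Set (ι → Bool)))
    (hB : IsUpperSet (B : Set (ι → Bool))) :
    (∑ ω ∈ A, ∏ i, (if ω i then p i else 1 - p i))
        * (∑ ω ∈ B, ∏ i, (if ω i then p i else 1 - p i))
      ≤ ∑ ω ∈ A ∩ B, ∏ i, (if ω i then p i else 1 - p i) := by
  have hf0 : (0 : (ι → Bool) → ℝ) ≤ fun ω => if ω ∈ A then (1 : ℝ) else 0 := fun ω => by
    dsimp only
    split_ifs <;> norm_num
  have hg0 : (0 : (ι → Bool) → ℝ) ≤ fun ω => if ω ∈ B then (1 : ℝ) else 0 := fun ω => by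
    dsimp only
    split_ifs <;> norm_num
  have key := harris_finite_fun p hp0 hp1 _ _ hf0 hg0
    (monotone_indicator_of_isUpperSet A hA) (monotone_indicator_of_isUpperSet B hB)
  have hfg : ∀ ω : ι → Bool,
      (if ω ∈ A then (1 : ℝ) else 0) * (if ω ∈ B then (1 : ℝ) else 0)
        = if ω ∈ A ∩ B then (1 : ℝ) else 0 := by
    intro ω
    by_cases h1 : ω ∈ A <;> by_cases h2 : ω ∈ B <;> simp [h1, h2]
  simp only [hfg, mul_ite, mul_one, mul_zero, Finset.sum_ite_mem, Finset.univ_inter] at key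
  exact key

end Summit.Ventures.PercRepro0.HarrisFinite
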